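import Summits.CriticalPhenomena.CardyFormulaZ2.Theorems.CardyMagicRigidityNestingRigidityDomainEnsembleGluing
import HarnessLib

/-!
# `KernelUniqueness` reduced to precompactness and first-generation limit transfer (line `markov-cascade-one-generation`, crux `NestingRigidity`)

Crux `Summit.CriticalPhenomena.CardyFormulaZ2.Theses.CardyMagicRigidity.NestingRigidity`
(stmt-CriticalPhenomena-4835), line `markov-cascade-one-generation`, stub `stub_kernelUniqueness :
KernelUniqueness` (`DomainTransfer → KernelTransfer`, S4).  The stub is not provable today (XL⁻, no
template in print); this file isolates, in the line's own relative lattice clothing and with no new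
definition, the two analytic inputs its intended proof ("pass to subsequential limits along `uδ → u`;
identify the limit kernels through their hole transforms") consists of, and proves that they suffice:

* `hT` — PRECOMPACTNESS of the `𝕋` first-generation kernels in DKKMO's coupling distance along every
  family of two-sided holes (Aizenman–Burchard tightness + completeness, `𝕋` side only; the tree's
  `isTightLaws_map_triLoopCollection_holds` is the AB-space, all-loops, Jordan-domain version);
* `hR` — FIRST-GENERATION LIMIT TRANSFER: given `DomainTransfer`, the `ℤ²` first-generation kernels
  converge to every subsequential `d_CN`-limit of the `𝕋` ones along the same holes (the NEW theorem:
  domain nesting rigidity — merged hole transforms in all sub-holes identify the law of the outermost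
  loops; on `𝕋` the limit is CLE₆'s first generation by Camia–Newman);

`kernelTransfer_of_precompact_of_limitTransfer : hT → hR' → KernelTransfer` (subsequence principle
`Filter.tendsto_of_subseq_tendsto` + the gluing estimate `cnLawEDist_firstGen_domLoops_le_add` of the
sibling file `…DomainEnsembleGluing`), and `kernelUniqueness_of_precompact_of_limitTransfer`.
-/

noncomputable section

open MeasureTheory Set Filter
open scoped Topology BigOperators ENNReal Real

namespace Summit.CriticalPhenomena.CardyFormulaZ2.Cruxes.NestingRigidity.MarkovCascadeOneGeneration

open Literature.Probability.RandomPlanarGeometry Literature.Probability.Percolation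
  Literature.Probability.LatticeModels

/-! ## KernelTransfer from 𝕋-precompactness and limit transfer (subsequence principle) -/

/-- **`KernelTransfer` from precompactness of the `𝕋` first generations and limit transfer.**
Suppose (hypothesis `hT`, Aizenman–Burchard-type precompactness on the `𝕋` side, in `d_CN`): along
every family `uδ → u` with two-sided limit and every sequence of meshes `s n → 0⁺`, some subsequence
of the laws of the `𝕋` first generations `firstGen ∘ domLoopsT (holeOf (uδ (s n))) (s n)` converges in
DKKMO's coupling distance to a law presented on the unit interval; and (hypothesis `hR`, FIRST-
GENERATION LIMIT TRANSFER — the continuum content of `stub_kernelUniqueness`): whenever the `𝕋` first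
generations converge to such a limit along a sequence of meshes, so do the `ℤ²` first generations of
the same holes.  Then `KernelTransfer` holds: a real function tends to `0` along `𝓝[>] 0` iff every
sequence has a subsequence along which it does (`Filter.tendsto_of_subseq_tendsto`), and along the
subsequence produced by `hT` the two first-generation laws are both close to the common limit, hence
to each other by the gluing estimate `cnLawEDist_firstGen_domLoops_le_add` (triangle inequality for
`d_CN` through an arbitrary middle law, standard Borel lattice spaces). -/
theorem kernelTransfer_of_precompact_of_limitTransfer :
    (∀ (u : UnbasedLoop ℂ) (uδ : ℝ → UnbasedLoop ℂ) (s : ℕ → ℝ), TwoSided u →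
      Tendsto uδ (𝓝[>] 0) (𝓝 u) → Tendsto s atTop (𝓝[>] 0) →
        ∃ (φ : ℕ → ℕ) (P : Measure unitInterval) (X : unitInterval → LoopConfig ℂ),
          StrictMono φ ∧ IsProbabilityMeasure P ∧
          Tendsto (fun n ↦ LoopConfig.cnLawEDist PT
            (fun ω ↦ firstGen (domLoopsT (holeOf (uδ (s (φ n)))) (s (φ n)) ω)) P X) atTop (𝓝 0)) →
    (∀ (u : UnbasedLoop ℂ) (uδ : ℝ → UnbasedLoop ℂ) (s : ℕ → ℝ) (P : Measure unitInterval)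
      (X : unitInterval → LoopConfig ℂ), IsProbabilityMeasure P → TwoSided u →
      Tendsto uδ (𝓝[>] 0) (𝓝 u) → Tendsto s atTop (𝓝[>] 0) →
      Tendsto (fun n ↦ LoopConfig.cnLawEDist PT
        (fun ω ↦ firstGen (domLoopsT (holeOf (uδ (s n))) (s n) ω)) P X) atTop (𝓝 0) →
      Tendsto (fun n ↦ LoopConfig.cnLawEDist P2
        (fun ω ↦ firstGen (domLoopsZ2 (holeOf (uδ (s n))) (s n) ω)) P X) atTop (𝓝 0)) →
    KernelTransfer := by
  intro hT hR u uδ hu huδ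
  refine Filter.tendsto_of_subseq_tendsto fun s hs ↦ ?_
  obtain ⟨φ, P, X, hφ, hP, hTlim⟩ := hT u uδ s hu huδ hs
  have hs' : Tendsto (s ∘ φ) atTop (𝓝[>] 0) := hs.comp hφ.tendsto_atTop
  have hZlim := hR u uδ (s ∘ φ) P X hP hu huδ hs' hTlim
  refine ⟨φ, tendsto_of_tendsto_of_tendsto_of_le_of_le tendsto_const_nhds ?_ (fun _ ↦ bot_le)
    fun n ↦ cnLawEDist_firstGen_domLoops_le_add P X
      (holeOf (uδ (s (φ n)))) (holeOf (uδ (s (φ n)))) (s (φ n)) (s (φ n))⟩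
  simpa using hZlim.add hTlim

/-- **`KernelUniqueness` reduced to two named analytic inputs**: `𝕋`-precompactness of the first
generations (`hT`) and FIRST-GENERATION LIMIT TRANSFER from merged domain transforms (`hR`:
`DomainTransfer` ⇒ the `ℤ²` first generations converge to every subsequential `d_CN`-limit of the `𝕋`
first generations along the same holes).  The second input is the genuinely new theorem the stub
hinges on ("domain nesting rigidity": the first generation is heard through its holes); the first is
Aizenman–Burchard tightness in `d_CN` clothing. -/
theorem kernelUniqueness_of_precompact_of_limitTransfer :
    (∀ (u : UnbasedLoop ℂ) (uδ : ℝ → UnbasedLoop ℂ) (s : ℕ → ℝ), TwoSided u →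
      Tendsto uδ (𝓝[>] 0) (𝓝 u) → Tendsto s atTop (𝓝[>] 0) →
        ∃ (φ : ℕ → ℕ) (P : Measure unitInterval) (X : unitInterval → LoopConfig ℂ),
          StrictMono φ ∧ IsProbabilityMeasure P ∧
          Tendsto (fun n ↦ LoopConfig.cnLawEDist PT
            (fun ω ↦ firstGen (domLoopsT (holeOf (uδ (s (φ n)))) (s (φ n)) ω)) P X) atTop (𝓝 0)) →
    (DomainTransfer → ∀ (u : UnbasedLoop ℂ) (uδ : ℝ → UnbasedLoop ℂ) (s : ℕ → ℝ) (P : Measure unitInterval)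
      (X : unitInterval → LoopConfig ℂ), IsProbabilityMeasure P → TwoSided u →
      Tendsto uδ (𝓝[>] 0) (𝓝 u) → Tendsto s atTop (𝓝[>] 0) →
      Tendsto (fun n ↦ LoopConfig.cnLawEDist PT
        (fun ω ↦ firstGen (domLoopsT (holeOf (uδ (s n))) (s n) ω)) P X) atTop (𝓝 0) →
      Tendsto (fun n ↦ LoopConfig.cnLawEDist P2
        (fun ω ↦ firstGen (domLoopsZ2 (holeOf (uδ (s n))) (s n) ω)) P X) atTop (𝓝 0)) →
    KernelUniqueness :=
  fun hT hR hD ↦ kernelTransfer_of_precompact_of_limitTransfer hT (hR hD)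

end Summit.CriticalPhenomena.CardyFormulaZ2.Cruxes.NestingRigidity.MarkovCascadeOneGeneration

end
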